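import Literature.Barriers.PneNP.SuperconcentratorBarrier
import Literature.Combinatorics.Expanders.Concentrator
import Mathlib.Algebra.Order.BigOperators.Group.Finset
import Mathlib.Algebra.BigOperators.Ring.Finset
import Mathlib.Data.Fin.SuccPred
import HarnessLib

/-!
# Linear-size superconcentrators exist: proof of `SuperconcentratorBarrier`

`Literature/Barriers/PneNP/SuperconcentratorBarrier.lean` vendors the existence of `n`-superconcentrators
with `O(n)` wires (Valiant 1976; Pinsker; Pippenger 1977) as the named fact
`Literature.Barriers.PneNP.SuperconcentratorBarrier`:
`∃ c n₀, ∀ n ≥ n₀, ∃ G : IONetwork n, G.IsSuperconcentrator ∧ G.edgeCount ≤ c * n`.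
This file PROVES it (`SuperconcentratorBarrier_holds`, with `c = 915`, `n₀ = 1`), following the
printed proof of [BurgisserClausenShokrollahi1997] Thm. (13.31) (Pinsker, Valiant:
`s(n) ≤ 13n + s(4⌈n/6⌉)`, hence `s(n) ≤ 39n + O(log n)`): an `n`-superconcentrator is a perfect
matching inputs → outputs, plus a sparse bipartite "concentrator" from the inputs into a smaller
set `I'`, a superconcentrator from `I'` to `O'` (recursively), and the transposed concentrator
from `O'` to the outputs; to connect `X` to `Y` one routes `X ∩ Y` (as index sets) through the
matching and the rest — at most `n/2` indices on each side, since `X \ Y` and `Y \ X` are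
disjoint — through the concentrators (Hall's theorem) and the inner superconcentrator
([BurgisserClausenShokrollahi1997] PDF p. 358; [Chung1997] Ch. 6, Figure 3).

**Formalisation choices** (constants are ours; only `O(n)` is claimed by the fact).
* The concentrator is `Literature.Combinatorics.Expanders.exists_halfConcentrator` (counting
  argument, the role of [BurgisserClausenShokrollahi1997] Lemma (13.32)): `a` inputs,
  `a - ⌊a/16⌋` outputs, left degree `≤ 7`, Hall's condition for all sets of `≤ ⌊a/2⌋` inputs.
* The recursion is unrolled into ONE leveled graph `PinskerValiant.net n` on the vertex type
  `Fin (n+1) × Fin n × Bool` (level, index, input/output side): level `ℓ` carries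
  `sz n ℓ` input-side and `sz n ℓ` output-side vertices (`sz n 0 = n`,
  `sz n (ℓ+1) = sz n ℓ - ⌊sz n ℓ / 16⌋`), the matching `(ℓ, i, in) → (ℓ, i, out)`, the
  concentrator edges `(ℓ, x, in) → (ℓ+1, y, in)` and their transposes
  `(ℓ+1, y, out) → (ℓ, x, out)`, and at the last level `ℓ = n` (where `sz n n ≤ 15`) the
  complete bipartite graph. Unused vertices are isolated and cost nothing (only wires count).
* `PinskerValiant.LevelLinked n ℓ` is the superconcentrator property of the sub-network of
  levels `≥ ℓ`, proved by downward induction on `ℓ` (`levelLinked_self`, `levelLinked_step`,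
  whose combinatorial heart is the gluing lemma `glue`); level `0` is
  `IONetwork.IsSuperconcentrator` (`isSuperconcentrator_net`).
* Wires: `≤ 15 · ∑_ℓ sz n ℓ + 225 ≤ 915 n` (`card_edges_le`, `sum_sz_le`: the potential
  `16 (sz n (ℓ+1) - 15) ≤ 15 (sz n ℓ - 15)` gives `∑_{ℓ ≤ n} sz n ℓ ≤ 16 n + 15 (n + 1)`).
The graph happens to be a standard acyclic network (rank: input side of level `ℓ` ↦ `ℓ`,
output side ↦ `2n + 1 - ℓ`), of depth `Θ(n)` — this is not needed and not proved; the
logarithmic-depth form `SuperconcentratorBarrierLogDepth` (Pippenger 1977) would need the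
recursion stopped after `O(log n)` levels with a final `O(n)`-size gadget and is NOT proved
here.

## References

* [BurgisserClausenShokrollahi1997] P. Bürgisser, M. Clausen, M. A. Shokrollahi, *Algebraic
  Complexity Theory* (1997), Thm. (13.31) and Lemma (13.32) with proofs (PDF pp. 356–358) — held.
* [Chung1997] F. Chung, *Spectral Graph Theory* (1997), Ch. 6 (PDF pp. 82–83) — held.
* [Drucker2012] A. Drucker, *Limitations of lower-bound methods for the wire complexity of
  Boolean operators*, CCC 2012, §1.2 p. 5 ("there exist superconcentrators with `O(n)` wires
  [Val76, Val77]") — held; the sentence this discharge backs.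
* [Valiant1976GraphTheoretic], [Pippenger1977] — the original results (not held).
-/

namespace Literature.Barriers.PneNP

open Finset

namespace PinskerValiant

/-! ### Level sizes -/

/-- One step of the size recursion: `a ↦ a - ⌊a/16⌋` (the next level has the size of the
concentrator's output side). [cite: BurgisserClausenShokrollahi1997, Thm. (13.31) (there `n ↦ 4⌈n/6⌉`)] -/
def shrink (a : ℕ) : ℕ := a - a / 16

/-- The number of input-side (= output-side) vertices at level `ℓ` of the network for `n`:
`sz n 0 = n`, `sz n (ℓ+1) = shrink (sz n ℓ)`. [cite: BurgisserClausenShokrollahi1997, Thm. (13.31)] -/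
def sz (n : ℕ) : ℕ → ℕ
  | 0 => n
  | ℓ + 1 => shrink (sz n ℓ)

/-- `shrink a ≤ a`. [folklore] -/
theorem shrink_le (a : ℕ) : shrink a ≤ a := Nat.sub_le _ _

/-- `sz n 0 = n`. [folklore] -/
theorem sz_zero (n : ℕ) : sz n 0 = n := rfl

/-- `sz n (ℓ+1) = shrink (sz n ℓ)`. [folklore] -/
theorem sz_succ (n ℓ : ℕ) : sz n (ℓ + 1) = shrink (sz n ℓ) := rfl

/-- Level sizes never exceed `n`. [folklore] -/
theorem sz_le (n : ℕ) : ∀ ℓ, sz n ℓ ≤ n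
  | 0 => le_rfl
  | ℓ + 1 => (shrink_le _).trans (sz_le n ℓ)

/-- Either the level size is already `≤ 15`, or it has dropped by at least one per level.
[folklore] -/
theorem sz_small_or (n : ℕ) : ∀ ℓ, sz n ℓ ≤ 15 ∨ sz n ℓ + ℓ ≤ n
  | 0 => Or.inr (by simp [sz])
  | ℓ + 1 => by
      rcases sz_small_or n ℓ with h | h
      · exact Or.inl ((shrink_le _).trans h)
      · by_cases h' : sz n ℓ ≤ 15
        · exact Or.inl ((shrink_le _).trans h')
        · right
          simp only [sz_succ, shrink]
          omega

/-- The last level is small: `sz n n ≤ 15`. [folklore] -/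
theorem sz_self_le (n : ℕ) : sz n n ≤ 15 := by
  rcases sz_small_or n n with h | h
  · exact h
  · omega

/-- The potential drop `16 · (sz n (ℓ+1) - 15) ≤ 15 · (sz n ℓ - 15)`. [folklore] -/
theorem sz_potential (n ℓ : ℕ) : 16 * (sz n (ℓ + 1) - 15) ≤ 15 * (sz n ℓ - 15) := by
  simp only [sz_succ, shrink]
  omega

/-- The level sizes sum to `O(n)`: `∑_{ℓ ≤ L} sz n ℓ ≤ 16 n + 15 (L + 1)`. [folklore] -/
theorem sum_sz_le (n L : ℕ) : ∑ ℓ ∈ range (L + 1), sz n ℓ ≤ 16 * n + 15 * (L + 1) := by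
  have key : ∀ L, 16 * ∑ ℓ ∈ range (L + 1), (sz n ℓ - 15) ≤
      16 * (sz n 0 - 15) + 15 * ∑ ℓ ∈ range L, (sz n ℓ - 15) := by
    intro L
    induction L with
    | zero => simp
    | succ L ih =>
        have h1 : ∑ ℓ ∈ range (L + 1 + 1), (sz n ℓ - 15) =
            ∑ ℓ ∈ range (L + 1), (sz n ℓ - 15) + (sz n (L + 1) - 15) := sum_range_succ _ _
        have h2 : ∑ ℓ ∈ range (L + 1), (sz n ℓ - 15) =
            ∑ ℓ ∈ range L, (sz n ℓ - 15) + (sz n L - 15) := sum_range_succ _ _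
        have := sz_potential n L
        omega
  have hT : ∑ ℓ ∈ range (L + 1), (sz n ℓ - 15) ≤ 16 * (sz n 0 - 15) := by
    have h1 := key L
    have h2 : ∑ ℓ ∈ range L, (sz n ℓ - 15) ≤ ∑ ℓ ∈ range (L + 1), (sz n ℓ - 15) :=
      sum_le_sum_of_subset (range_mono (Nat.le_succ L))
    omega
  have h3 : ∑ ℓ ∈ range (L + 1), sz n ℓ ≤ ∑ ℓ ∈ range (L + 1), ((sz n ℓ - 15) + 15) :=
    sum_le_sum fun ℓ _ => by omega
  rw [sum_add_distrib, sum_const, card_range, smul_eq_mul] at h3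
  have hm0 : sz n 0 - 15 ≤ n := by simp only [sz_zero]; omega
  omega

/-! ### The network -/

/-- Vertices of the network for `n`: (level `≤ n`, index `< n`, side), side `false` = input
side, `true` = output side. [cite: BurgisserClausenShokrollahi1997, Thm. (13.31) (Fig. 13.1)] -/
abbrev Vtx (n : ℕ) : Type := Fin (n + 1) × Fin n × Bool

/-- Level `ℓ` as an element of `Fin (n+1)` (truncated at `n`; used only for `ℓ ≤ n`). [folklore] -/
def lv (n ℓ : ℕ) : Fin (n + 1) := ⟨min ℓ n, by omega⟩

/-- `(lv n ℓ : ℕ) = min ℓ n`. [folklore] -/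
@[simp] theorem val_lv (n ℓ : ℕ) : ((lv n ℓ : Fin (n + 1)) : ℕ) = min ℓ n := rfl

/-- An index of level `ℓ` as an element of `Fin n`. [folklore] -/
def emb (n ℓ : ℕ) (x : Fin (sz n ℓ)) : Fin n := x.castLE (sz_le n ℓ)

/-- An index of the concentrator's output side at level `ℓ` (= an index of level `ℓ+1`) as an
element of `Fin n`. [folklore] -/
def up (n ℓ : ℕ) (y : Fin (shrink (sz n ℓ))) : Fin n :=
  y.castLE ((shrink_le _).trans (sz_le n ℓ))

/-- `up` is injective. [folklore] -/
theorem up_injective (n ℓ : ℕ) : Function.Injective (up n ℓ) :=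
  Fin.castLE_injective ((shrink_le _).trans (sz_le n ℓ))

/-- The concentrator of `Literature.Combinatorics.Expanders.exists_halfConcentrator` with `a`
inputs: neighbourhoods in `Fin (shrink a)` of size `≤ 7`, Hall's condition up to `⌊a/2⌋`.
[cite: BurgisserClausenShokrollahi1997, Lemma (13.32) (PDF pp. 356–357)] -/
theorem conc_exists (a : ℕ) :
    ∃ N : Fin a → Finset (Fin (shrink a)), (∀ x, (N x).card ≤ 7) ∧
      ∀ S : Finset (Fin a), S.card ≤ a / 2 → S.card ≤ (S.biUnion N).card :=
  Literature.Combinatorics.Expanders.exists_halfConcentrator a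

/-- A chosen concentrator with `a` inputs (non-constructive). [cite: BurgisserClausenShokrollahi1997, Lemma (13.32)] -/
noncomputable def conc (a : ℕ) : Fin a → Finset (Fin (shrink a)) :=
  Classical.choose (conc_exists a)

/-- Left degrees of `conc a` are `≤ 7`. [cite: BurgisserClausenShokrollahi1997, Lemma (13.32)] -/
theorem conc_card (a : ℕ) (x : Fin a) : (conc a x).card ≤ 7 :=
  (Classical.choose_spec (conc_exists a)).1 x

/-- Hall's condition for `conc a` up to `⌊a/2⌋`. [cite: BurgisserClausenShokrollahi1997, Lemma (13.32)] -/
theorem conc_hall (a : ℕ) :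
    ∀ S : Finset (Fin a), S.card ≤ a / 2 → S.card ≤ (S.biUnion (conc a)).card :=
  (Classical.choose_spec (conc_exists a)).2

/-- The matching wires `(ℓ, x, in) → (ℓ, x, out)` of level `ℓ` (the bijection `σ` of
[BurgisserClausenShokrollahi1997] p. 358, here the identity). [cite: BurgisserClausenShokrollahi1997, Thm. (13.31)] -/
def directE (n ℓ : ℕ) : Finset (Vtx n × Vtx n) :=
  (univ : Finset (Fin (sz n ℓ))).image fun x => ((lv n ℓ, emb n ℓ x, false), (lv n ℓ, emb n ℓ x, true))

/-- The concentrator wires `(ℓ, x, in) → (ℓ+1, y, in)`, `y ∈ conc x` (the graph `G` of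
[BurgisserClausenShokrollahi1997] p. 358). [cite: BurgisserClausenShokrollahi1997, Thm. (13.31)] -/
noncomputable def concInE (n ℓ : ℕ) : Finset (Vtx n × Vtx n) :=
  (univ : Finset (Fin (sz n ℓ))).biUnion fun x =>
    (conc (sz n ℓ) x).image fun y => ((lv n ℓ, emb n ℓ x, false), (lv n (ℓ + 1), up n ℓ y, false))

/-- The transposed concentrator wires `(ℓ+1, y, out) → (ℓ, x, out)`, `y ∈ conc x` (the graph
`Gᵀ` of [BurgisserClausenShokrollahi1997] p. 358). [cite: BurgisserClausenShokrollahi1997, Thm. (13.31)] -/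
noncomputable def concOutE (n ℓ : ℕ) : Finset (Vtx n × Vtx n) :=
  (univ : Finset (Fin (sz n ℓ))).biUnion fun x =>
    (conc (sz n ℓ) x).image fun y => ((lv n (ℓ + 1), up n ℓ y, true), (lv n ℓ, emb n ℓ x, true))

/-- The complete bipartite graph at the last level `n` (`sz n n ≤ 15`), the base of the
recursion. [cite: Jukna2012, §13.4 p. 388 (`c₁(n) = n²`)] -/
def lastE (n : ℕ) : Finset (Vtx n × Vtx n) :=
  (univ : Finset (Fin (sz n n) × Fin (sz n n))).image fun p =>
    ((lv n n, emb n n p.1, false), (lv n n, emb n n p.2, true))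

/-- All wires of the network for `n`. [cite: BurgisserClausenShokrollahi1997, Thm. (13.31) (Fig. 13.1)] -/
noncomputable def edges (n : ℕ) : Finset (Vtx n × Vtx n) :=
  ((range (n + 1)).biUnion (directE n) ∪ (range n).biUnion (concInE n)) ∪
    ((range n).biUnion (concOutE n) ∪ lastE n)

/-- **The Pinsker–Valiant network** for `n`, as an `IONetwork n`: inputs `(0, i, in)`, outputs
`(0, i, out)`. [cite: BurgisserClausenShokrollahi1997, Thm. (13.31)] -/
noncomputable def net (n : ℕ) : IONetwork n where
  V := Vtx n
  edges := edges n
  input := ⟨fun i => ((0 : Fin (n + 1)), i, false), fun i j h => by simpa using h⟩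
  output := ⟨fun i => ((0 : Fin (n + 1)), i, true), fun i j h => by simpa using h⟩

/-- Directed paths of `net n`, unfolded. [folklore] -/
theorem isDiPath_net {n : ℕ} {p : List (Vtx n)} :
    (net n).IsDiPath p ↔ p ≠ [] ∧ p.IsChain (fun u v => (u, v) ∈ edges n) ∧ p.Nodup :=
  Iff.rfl

/-! ### Wire membership -/

/-- Matching wires are wires. [folklore] -/
theorem direct_mem {n ℓ : ℕ} (hℓ : ℓ ≤ n) (i : Fin n) (hi : i.val < sz n ℓ) :
    ((lv n ℓ, i, false), (lv n ℓ, i, true)) ∈ edges n := by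
  refine mem_union_left _ (mem_union_left _ (mem_biUnion.2 ⟨ℓ, mem_range.2 (by omega), ?_⟩))
  exact mem_image.2 ⟨⟨i.val, hi⟩, mem_univ _, rfl⟩

/-- Concentrator wires are wires. [folklore] -/
theorem concIn_mem {n ℓ : ℕ} (hℓ : ℓ < n) (i : Fin n) (hi : i.val < sz n ℓ)
    (y : Fin (shrink (sz n ℓ))) (hy : y ∈ conc (sz n ℓ) ⟨i.val, hi⟩) :
    ((lv n ℓ, i, false), (lv n (ℓ + 1), up n ℓ y, false)) ∈ edges n := by
  refine mem_union_left _ (mem_union_right _ (mem_biUnion.2 ⟨ℓ, mem_range.2 hℓ, ?_⟩))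
  exact mem_biUnion.2 ⟨⟨i.val, hi⟩, mem_univ _, mem_image.2 ⟨y, hy, rfl⟩⟩

/-- Transposed concentrator wires are wires. [folklore] -/
theorem concOut_mem {n ℓ : ℕ} (hℓ : ℓ < n) (j : Fin n) (hj : j.val < sz n ℓ)
    (y : Fin (shrink (sz n ℓ))) (hy : y ∈ conc (sz n ℓ) ⟨j.val, hj⟩) :
    ((lv n (ℓ + 1), up n ℓ y, true), (lv n ℓ, j, true)) ∈ edges n := by
  refine mem_union_right _ (mem_union_left _ (mem_biUnion.2 ⟨ℓ, mem_range.2 hℓ, ?_⟩))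
  exact mem_biUnion.2 ⟨⟨j.val, hj⟩, mem_univ _, mem_image.2 ⟨y, hy, rfl⟩⟩

/-- Last-level wires are wires. [folklore] -/
theorem last_mem {n : ℕ} (i j : Fin n) (hi : i.val < sz n n) (hj : j.val < sz n n) :
    ((lv n n, i, false), (lv n n, j, true)) ∈ edges n :=
  mem_union_right _ (mem_union_right _
    (mem_image.2 ⟨(⟨i.val, hi⟩, ⟨j.val, hj⟩), mem_univ _, rfl⟩))

/-! ### Wire count -/

/-- `|E(net n)| ≤ 15 · ∑_{ℓ ≤ n} sz n ℓ + 225`. [cite: BurgisserClausenShokrollahi1997, Thm. (13.31) (there `13n + s(4m)`)] -/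
theorem card_edges_le (n : ℕ) : (edges n).card ≤ 15 * ∑ ℓ ∈ range (n + 1), sz n ℓ + 225 := by
  have hA : ((range (n + 1)).biUnion (directE n)).card ≤ ∑ ℓ ∈ range (n + 1), sz n ℓ :=
    card_biUnion_le.trans (sum_le_sum fun ℓ _ => card_image_le.trans (by simp))
  have h7 : ∀ ℓ, ∑ x : Fin (sz n ℓ), (conc (sz n ℓ) x).card ≤ 7 * sz n ℓ := fun ℓ =>
    (sum_le_sum fun x _ => conc_card _ x).trans (by simp [mul_comm])
  have hIn : ∀ ℓ, (concInE n ℓ).card ≤ 7 * sz n ℓ := fun ℓ =>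
    card_biUnion_le.trans ((sum_le_sum fun x _ => card_image_le).trans (h7 ℓ))
  have hOut : ∀ ℓ, (concOutE n ℓ).card ≤ 7 * sz n ℓ := fun ℓ =>
    card_biUnion_le.trans ((sum_le_sum fun x _ => card_image_le).trans (h7 ℓ))
  have hsum7 : ∑ ℓ ∈ range n, 7 * sz n ℓ ≤ 7 * ∑ ℓ ∈ range (n + 1), sz n ℓ := by
    rw [← mul_sum]
    exact Nat.mul_le_mul_left _ (sum_le_sum_of_subset (range_mono (Nat.le_succ n)))
  have hB : ((range n).biUnion (concInE n)).card ≤ 7 * ∑ ℓ ∈ range (n + 1), sz n ℓ :=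
    card_biUnion_le.trans ((sum_le_sum fun ℓ _ => hIn ℓ).trans hsum7)
  have hC : ((range n).biUnion (concOutE n)).card ≤ 7 * ∑ ℓ ∈ range (n + 1), sz n ℓ :=
    card_biUnion_le.trans ((sum_le_sum fun ℓ _ => hOut ℓ).trans hsum7)
  have hD : (lastE n).card ≤ 225 := by
    refine card_image_le.trans ?_
    rw [card_univ, Fintype.card_prod, Fintype.card_fin]
    have := sz_self_le n
    exact (Nat.mul_le_mul this this).trans (by norm_num)
  calc (edges n).card
      ≤ ((range (n + 1)).biUnion (directE n) ∪ (range n).biUnion (concInE n)).card +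
          ((range n).biUnion (concOutE n) ∪ lastE n).card := card_union_le _ _
    _ ≤ (((range (n + 1)).biUnion (directE n)).card + ((range n).biUnion (concInE n)).card) +
          (((range n).biUnion (concOutE n)).card + (lastE n).card) :=
        add_le_add (card_union_le _ _) (card_union_le _ _)
    _ ≤ 15 * ∑ ℓ ∈ range (n + 1), sz n ℓ + 225 := by omega

/-- **Linear size**: `net n` has at most `915 n` wires for `n ≥ 1`
(`15 (16 n + 15 (n+1)) + 225 ≤ 915 n`). [cite: BurgisserClausenShokrollahi1997, Thm. (13.31) (`39n + O(log n)` there)] -/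
theorem edgeCount_net_le {n : ℕ} (hn : 1 ≤ n) : (net n).edgeCount ≤ 915 * n := by
  have h1 := card_edges_le n
  have h2 := sum_sz_le n n
  show (edges n).card ≤ 915 * n
  omega

/-! ### Linking level by level -/

/-- **The sub-network of levels `≥ ℓ` is a superconcentrator** (with bookkeeping): for all
equal-size index sets `X, Y` below `sz n ℓ` there are pairwise vertex-disjoint directed paths
`P i`, `i ∈ X`, from `(ℓ, i, in)` to `(ℓ, τ i, out)` with `τ i ∈ Y`, using only vertices of
level `≥ ℓ`. [cite: BurgisserClausenShokrollahi1997, Thm. (13.31) (proof, PDF p. 358)] -/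
def LevelLinked (n ℓ : ℕ) : Prop :=
  ∀ X Y : Finset (Fin n), (∀ i ∈ X, i.val < sz n ℓ) → (∀ j ∈ Y, j.val < sz n ℓ) →
    X.card = Y.card →
    ∃ (P : Fin n → List (Vtx n)) (τ : Fin n → Fin n),
      (∀ i ∈ X, (net n).IsDiPath (P i) ∧ (P i).head? = some (lv n ℓ, i, false) ∧ τ i ∈ Y ∧
          (P i).getLast? = some (lv n ℓ, τ i, true) ∧ ∀ v ∈ P i, ℓ ≤ (v.1 : ℕ)) ∧
      ∀ i ∈ X, ∀ i' ∈ X, i ≠ i' → List.Disjoint (P i) (P i')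

/-- Base of the induction: the last level is a complete bipartite graph, linked along any
bijection `X ≃ Y` by one-wire paths. [cite: Jukna2012, §13.4 p. 388 (`c₁(n) = n²`)] -/
theorem levelLinked_self (n : ℕ) : LevelLinked n n := by
  classical
  intro X Y hX hY hXY
  let e : X ≃ Y := (X.equivFinOfCardEq hXY).trans Y.equivFin.symm
  refine ⟨fun i => if hi : i ∈ X then [(lv n n, i, false), (lv n n, (e ⟨i, hi⟩).1, true)] else [],
    fun i => if hi : i ∈ X then (e ⟨i, hi⟩).1 else i, ?_, ?_⟩
  · intro i hi
    simp only [hi, dif_pos]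
    refine ⟨isDiPath_net.2 ⟨List.cons_ne_nil _ _,
      List.isChain_pair.2 (last_mem i _ (hX i hi) (hY _ (e ⟨i, hi⟩).2)), by simp⟩,
      rfl, (e ⟨i, hi⟩).2, rfl, ?_⟩
    intro v hv
    simp only [List.mem_cons, List.not_mem_nil, or_false] at hv
    rcases hv with rfl | rfl <;> simp
  · intro i hi i' hi' hne
    simp only [hi, hi', dif_pos]
    have hinj : (e ⟨i, hi⟩).1 ≠ (e ⟨i', hi'⟩).1 := by
      intro h
      have := e.injective (Subtype.ext h)
      exact hne (by simpa using congrArg Subtype.val this)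
    intro v hv hv'
    simp only [List.mem_cons, List.not_mem_nil, or_false] at hv hv'
    rcases hv with rfl | rfl <;> rcases hv' with h | h
    · exact hne (by simpa using h)
    · simp at h
    · simp at h
    · exact hinj (by simpa using h)

/-- From `l.getLast? = some a` to `a ∈ l`. [folklore] -/
theorem mem_of_getLast?_eq {α : Type*} {l : List α} {a : α} (h : l.getLast? = some a) :
    a ∈ l := by
  have hne : l ≠ [] := by rintro rfl; simp at h
  rw [List.getLast?_eq_some_getLast hne] at h
  obtain rfl := Option.some.inj h
  exact List.getLast_mem hne

/-- `getLast?` of `a :: (l ++ [b])` is `b`. [folklore] -/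
theorem getLast?_cons_append_singleton {α : Type*} (a : α) (l : List α) (b : α) :
    (a :: (l ++ [b])).getLast? = some b := by
  rw [← List.cons_append, List.getLast?_append]
  rfl

/-- **The gluing step** ([BurgisserClausenShokrollahi1997] p. 358: "these four flows constitute
an `r`-flow from `X` to `Y`"). At level `ℓ < n`, route `i ∈ X ∩ Y` along the matching wire
`(ℓ, i, in) → (ℓ, i, out)`, and `i ∈ X \ Y` along
`(ℓ, i, in) → (ℓ+1, xo i, in) ⇝ (ℓ+1, τ' (xo i), out) → (ℓ, yo i, out)`, where the middle
paths live in levels `≥ ℓ+1`, are pairwise disjoint, and `yo i ∈ Y \ X` determines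
`τ' (xo i)`. [cite: BurgisserClausenShokrollahi1997, Thm. (13.31) (proof, PDF p. 358)] -/
theorem glue {n ℓ : ℕ} (hℓ : ℓ < n) {X Y : Finset (Fin n)} (hX : ∀ i ∈ X, i.val < sz n ℓ)
    (xo yo : (i : Fin n) → i ∈ X \ Y → Fin n) (P' : Fin n → List (Vtx n)) (τ' : Fin n → Fin n)
    (hpath : ∀ i (hi : i ∈ X \ Y), (net n).IsDiPath (P' (xo i hi)))
    (hhead : ∀ i (hi : i ∈ X \ Y), (P' (xo i hi)).head? = some (lv n (ℓ + 1), xo i hi, false))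
    (hlast : ∀ i (hi : i ∈ X \ Y),
      (P' (xo i hi)).getLast? = some (lv n (ℓ + 1), τ' (xo i hi), true))
    (hlev : ∀ i (hi : i ∈ X \ Y), ∀ v ∈ P' (xo i hi), ℓ + 1 ≤ (v.1 : ℕ))
    (hdisj : ∀ i (hi : i ∈ X \ Y) i' (hi' : i' ∈ X \ Y), i ≠ i' →
      List.Disjoint (P' (xo i hi)) (P' (xo i' hi')))
    (hxe : ∀ i (hi : i ∈ X \ Y), ((lv n ℓ, i, false), (lv n (ℓ + 1), xo i hi, false)) ∈ edges n)
    (hym : ∀ i (hi : i ∈ X \ Y), yo i hi ∈ Y \ X)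
    (hye : ∀ i (hi : i ∈ X \ Y),
      ((lv n (ℓ + 1), τ' (xo i hi), true), (lv n ℓ, yo i hi, true)) ∈ edges n)
    (hyi : ∀ i (hi : i ∈ X \ Y) i' (hi' : i' ∈ X \ Y), yo i hi = yo i' hi' →
      τ' (xo i hi) = τ' (xo i' hi')) :
    ∃ (P : Fin n → List (Vtx n)) (τ : Fin n → Fin n),
      (∀ i ∈ X, (net n).IsDiPath (P i) ∧ (P i).head? = some (lv n ℓ, i, false) ∧ τ i ∈ Y ∧
          (P i).getLast? = some (lv n ℓ, τ i, true) ∧ ∀ v ∈ P i, ℓ ≤ (v.1 : ℕ)) ∧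
      ∀ i ∈ X, ∀ i' ∈ X, i ≠ i' → List.Disjoint (P i) (P i') := by
  classical
  have hℓn : ℓ ≤ n := hℓ.le
  have hlvℓ : ((lv n ℓ : Fin (n + 1)) : ℕ) = ℓ := by simp [hℓn]
  -- no vertex of level `ℓ` lies on an inner path
  have hnotin : ∀ i (hi : i ∈ X \ Y) (j : Fin n) (b : Bool), (lv n ℓ, j, b) ∉ P' (xo i hi) := by
    intro i hi j b hmem
    have := hlev i hi _ hmem
    simp only [val_lv] at this
    omega
  refine ⟨fun i => if hi : i ∈ X \ Y then
      (lv n ℓ, i, false) :: (P' (xo i hi) ++ [(lv n ℓ, yo i hi, true)])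
      else [(lv n ℓ, i, false), (lv n ℓ, i, true)],
    fun i => if hi : i ∈ X \ Y then yo i hi else i, ?_, ?_⟩
  · intro i hiX
    by_cases hi : i ∈ X \ Y
    · simp only [hi, dif_pos]
      obtain ⟨hne, hch, hnd⟩ := isDiPath_net.1 (hpath i hi)
      obtain ⟨q, Q₀, hQ⟩ := List.exists_cons_of_ne_nil hne
      have hq : q = (lv n (ℓ + 1), xo i hi, false) := by
        have := hhead i hi
        rw [hQ] at this
        simpa using this
      refine ⟨isDiPath_net.2 ⟨List.cons_ne_nil _ _, ?_, ?_⟩, rfl, (mem_sdiff.1 (hym i hi)).1,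
        getLast?_cons_append_singleton _ _ _, ?_⟩
      · -- the chain condition
        refine List.IsChain.cons ?_ ?_
        · refine hch.append (List.isChain_singleton _) ?_
          intro x hx y hy
          rw [hlast i hi] at hx
          simp only [Option.mem_def, Option.some.injEq, List.head?_cons] at hx hy
          subst hx
          subst hy
          exact hye i hi
        · intro y hy
          rw [hQ] at hy
          simp only [List.cons_append, List.head?_cons, Option.mem_def, Option.some.injEq] at hy
          subst hy
          rw [hq]
          exact hxe i hi
      · -- no repeated vertex
        refine List.nodup_cons.2 ⟨?_, ?_⟩
        · simp only [List.mem_append, List.mem_singleton, not_or]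
          exact ⟨hnotin i hi i false, by simp⟩
        · refine List.nodup_append.2 ⟨hnd, List.nodup_singleton _, ?_⟩
          intro a ha b hb
          rw [List.mem_singleton] at hb
          subst hb
          intro hab
          subst hab
          exact hnotin i hi _ true ha
      · -- levels
        intro v hv
        simp only [List.mem_cons, List.mem_append, List.not_mem_nil, or_false] at hv
        rcases hv with rfl | hv | rfl
        · simp [hℓn]
        · exact (Nat.le_succ ℓ).trans (hlev i hi v hv)
        · simp [hℓn]
    · simp only [hi, dif_neg, not_false_eq_true]
      have hiY : i ∈ Y := by
        by_contra h
        exact hi (mem_sdiff.2 ⟨hiX, h⟩)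
      refine ⟨isDiPath_net.2 ⟨List.cons_ne_nil _ _, List.isChain_pair.2 (direct_mem hℓn i (hX i hiX)),
        by simp⟩, rfl, hiY, rfl, ?_⟩
      intro v hv
      simp only [List.mem_cons, List.not_mem_nil, or_false] at hv
      rcases hv with rfl | rfl <;> simp [hℓn]
  · intro i hiX i' hi'X hne
    by_cases hi : i ∈ X \ Y <;> by_cases hi' : i' ∈ X \ Y <;>
      simp only [hi, hi', dif_pos, dif_neg, not_false_eq_true] <;> intro v hv hv'
    · -- both routed through the inner network
      simp only [List.mem_cons, List.mem_append, List.not_mem_nil, or_false] at hv hv'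
      rcases hv with rfl | hv | rfl
      · rcases hv' with h | h | h
        · exact hne (by simpa using h)
        · exact hnotin i' hi' i false h
        · simp at h
      · rcases hv' with rfl | h | rfl
        · exact hnotin i hi i' false hv
        · exact hdisj i hi i' hi' hne hv h
        · exact hnotin i hi _ true hv
      · rcases hv' with h | h | h
        · simp at h
        · exact hnotin i' hi' _ true h
        · have hy : yo i hi = yo i' hi' := by simpa using h
          have hτ := hyi i hi i' hi' hy
          have m1 := mem_of_getLast?_eq (hlast i hi)
          have m2 := mem_of_getLast?_eq (hlast i' hi')
          rw [hτ] at m1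
          exact hdisj i hi i' hi' hne m1 m2
    · -- `i` inner, `i'` direct
      simp only [List.mem_cons, List.mem_append, List.not_mem_nil, or_false] at hv hv'
      rcases hv' with rfl | rfl
      · rcases hv with h | h | h
        · exact hne (by simpa using h.symm)
        · exact hnotin i hi i' false h
        · simp at h
      · rcases hv with h | h | h
        · simp at h
        · exact hnotin i hi i' true h
        · have hii : i' = yo i hi := by simpa using h
          have hm := hym i hi
          rw [← hii] at hm
          exact (mem_sdiff.1 hm).2 hi'X
    · -- `i` direct, `i'` inner
      simp only [List.mem_cons, List.mem_append, List.not_mem_nil, or_false] at hv hv'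
      rcases hv with rfl | rfl
      · rcases hv' with h | h | h
        · exact hne (by simpa using h)
        · exact hnotin i' hi' i false h
        · simp at h
      · rcases hv' with h | h | h
        · simp at h
        · exact hnotin i' hi' i true h
        · have hii : i = yo i' hi' := by simpa using h
          have hm := hym i' hi'
          rw [← hii] at hm
          exact (mem_sdiff.1 hm).2 hiX
    · -- both direct
      simp only [List.mem_cons, List.not_mem_nil, or_false] at hv hv'
      rcases hv with rfl | rfl <;> rcases hv' with h | h
      · exact hne (by simpa using h)
      · simp at h
      · simp at h
      · exact hne (by simpa using h)

/-- **The induction step** ([BurgisserClausenShokrollahi1997] p. 358): if levels `≥ ℓ+1` link,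
so do levels `≥ ℓ` — match `X \ Y` into level `ℓ+1` through the concentrator and `Y \ X`
through the transposed concentrator (Hall's theorem; `|X \ Y| = |Y \ X| ≤ ⌊sz n ℓ / 2⌋`
because the two sets are disjoint), link the images by the hypothesis, and glue.
[cite: BurgisserClausenShokrollahi1997, Thm. (13.31) (proof, PDF p. 358)] -/
theorem levelLinked_step {n ℓ : ℕ} (hℓ : ℓ < n) (ih : LevelLinked n (ℓ + 1)) :
    LevelLinked n ℓ := by
  classical
  intro X Y hX hY hXY
  have hcard₂ : (X \ Y).card = (Y \ X).card := by
    have h1 := card_sdiff_add_card_inter X Y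
    have h2 := card_sdiff_add_card_inter Y X
    rw [inter_comm] at h2
    omega
  have hhalf : (X \ Y).card ≤ sz n ℓ / 2 := by
    have hdisj : Disjoint (X \ Y) (Y \ X) :=
      disjoint_left.2 fun i hi hi' => (mem_sdiff.1 hi).2 (mem_sdiff.1 hi').1
    have hsub : ((X \ Y) ∪ (Y \ X)).card ≤ sz n ℓ := by
      have himg : ((X \ Y) ∪ (Y \ X)).image Fin.val ⊆ range (sz n ℓ) := by
        intro v hv
        obtain ⟨i, hi, rfl⟩ := mem_image.1 hv
        rcases mem_union.1 hi with h | h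
        · exact mem_range.2 (hX i (mem_sdiff.1 h).1)
        · exact mem_range.2 (hY i (mem_sdiff.1 h).1)
      calc ((X \ Y) ∪ (Y \ X)).card = (((X \ Y) ∪ (Y \ X)).image Fin.val).card :=
            (card_image_of_injective _ Fin.val_injective).symm
        _ ≤ (range (sz n ℓ)).card := card_le_card himg
        _ = sz n ℓ := card_range _
    rw [card_union_of_disjoint hdisj] at hsub
    omega
  have hhalf' : (Y \ X).card ≤ sz n ℓ / 2 := hcard₂ ▸ hhalf
  -- Hall matchings through the concentrator, on both sides
  let dn : ↥(X \ Y) → Fin (sz n ℓ) := fun x => ⟨x.1.val, hX x.1 (mem_sdiff.1 x.2).1⟩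
  have hdn : Function.Injective dn := by
    intro x y h
    apply Subtype.ext
    apply Fin.ext
    simpa [dn] using congrArg Fin.val h
  obtain ⟨μ, hμi, hμN⟩ := Literature.Combinatorics.Expanders.exists_injective_of_hall
    (conc (sz n ℓ)) (sz n ℓ / 2) (conc_hall (sz n ℓ)) dn hdn (by rw [Fintype.card_coe]; exact hhalf)
  let dn' : ↥(Y \ X) → Fin (sz n ℓ) := fun y => ⟨y.1.val, hY y.1 (mem_sdiff.1 y.2).1⟩
  have hdn' : Function.Injective dn' := by
    intro x y h
    apply Subtype.ext
    apply Fin.ext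
    simpa [dn'] using congrArg Fin.val h
  obtain ⟨ν, hνi, hνN⟩ := Literature.Combinatorics.Expanders.exists_injective_of_hall
    (conc (sz n ℓ)) (sz n ℓ / 2) (conc_hall (sz n ℓ)) dn' hdn' (by rw [Fintype.card_coe]; exact hhalf')
  -- the index sets at level `ℓ + 1`
  have hupμ : Function.Injective fun x : ↥(X \ Y) => up n ℓ (μ x) := (up_injective n ℓ).comp hμi
  have hupν : Function.Injective fun y : ↥(Y \ X) => up n ℓ (ν y) := (up_injective n ℓ).comp hνi
  let X' : Finset (Fin n) := univ.image fun x : ↥(X \ Y) => up n ℓ (μ x)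
  let Y' : Finset (Fin n) := univ.image fun y : ↥(Y \ X) => up n ℓ (ν y)
  have hX'c : X'.card = (X \ Y).card := by
    simp only [X']
    rw [card_image_of_injective _ hupμ, card_univ, Fintype.card_coe]
  have hY'c : Y'.card = (Y \ X).card := by
    simp only [Y']
    rw [card_image_of_injective _ hupν, card_univ, Fintype.card_coe]
  have hX'b : ∀ i ∈ X', i.val < sz n (ℓ + 1) := by
    intro i hi
    obtain ⟨x, -, rfl⟩ := mem_image.1 hi
    exact (μ x).2
  have hY'b : ∀ j ∈ Y', j.val < sz n (ℓ + 1) := by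
    intro j hj
    obtain ⟨y, -, rfl⟩ := mem_image.1 hj
    exact (ν y).2
  obtain ⟨P', τ', hP', hdisj'⟩ := ih X' Y' hX'b hY'b (by rw [hX'c, hY'c, hcard₂])
  -- entry points `xo` and exit points `yo`
  obtain ⟨xo, hxo⟩ : ∃ xo : (i : Fin n) → i ∈ X \ Y → Fin n,
      ∀ i hi, xo i hi = up n ℓ (μ ⟨i, hi⟩) := ⟨_, fun _ _ => rfl⟩
  have hxoX' : ∀ i hi, xo i hi ∈ X' := fun i hi => by
    rw [hxo]
    exact mem_image.2 ⟨⟨i, hi⟩, mem_univ _, rfl⟩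
  have hxo_inj : ∀ i hi i' hi', xo i hi = xo i' hi' → i = i' := by
    intro i hi i' hi' h
    rw [hxo, hxo] at h
    exact congrArg Subtype.val (hupμ h)
  have hex : ∀ i (hi : i ∈ X \ Y), ∃ y : ↥(Y \ X), up n ℓ (ν y) = τ' (xo i hi) := by
    intro i hi
    have hmem := (hP' (xo i hi) (hxoX' i hi)).2.2.1
    simpa [Y'] using hmem
  choose yo hyo using hex
  refine glue hℓ hX xo (fun i hi => (yo i hi).1) P' τ'
    (fun i hi => (hP' _ (hxoX' i hi)).1) (fun i hi => (hP' _ (hxoX' i hi)).2.1)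
    (fun i hi => (hP' _ (hxoX' i hi)).2.2.2.1) (fun i hi => (hP' _ (hxoX' i hi)).2.2.2.2)
    (fun i hi i' hi' hne => hdisj' _ (hxoX' i hi) _ (hxoX' i' hi')
      (fun h => hne (hxo_inj i hi i' hi' h)))
    (fun i hi => ?_) (fun i hi => (yo i hi).2) (fun i hi => ?_) (fun i hi i' hi' h => ?_)
  · rw [hxo]
    exact concIn_mem hℓ i (hX i (mem_sdiff.1 hi).1) (μ ⟨i, hi⟩) (hμN ⟨i, hi⟩)
  · rw [← hyo i hi]
    exact concOut_mem hℓ (yo i hi).1 (hY _ (mem_sdiff.1 (yo i hi).2).1) (ν (yo i hi)) (hνN (yo i hi))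
  · have hyy : yo i hi = yo i' hi' := Subtype.ext h
    rw [← hyo i hi, ← hyo i' hi', hyy]

/-- All levels link: `LevelLinked n (n - k)` for `k ≤ n`, by induction on `k`. [folklore] -/
theorem levelLinked_sub (n : ℕ) : ∀ k, k ≤ n → LevelLinked n (n - k)
  | 0, _ => by simpa using levelLinked_self n
  | k + 1, hk => by
      have ih := levelLinked_sub n k (Nat.le_of_succ_le hk)
      have heq : n - k = (n - (k + 1)) + 1 := by omega
      rw [heq] at ih
      exact levelLinked_step (by omega) ih

/-- **`net n` is an `n`-superconcentrator.** [cite: BurgisserClausenShokrollahi1997, Thm. (13.31)] -/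
theorem isSuperconcentrator_net (n : ℕ) : (net n).IsSuperconcentrator := by
  intro X Y hXY
  have h0 : LevelLinked n 0 := by simpa using levelLinked_sub n n le_rfl
  obtain ⟨P, τ, hP, hdisj⟩ := h0 X Y (fun i _ => i.2) (fun j _ => j.2) hXY
  have hlv0 : lv n 0 = (0 : Fin (n + 1)) := Fin.ext (by simp)
  refine ⟨P, fun i hi => ⟨(hP i hi).1, ?_, τ i, (hP i hi).2.2.1, ?_⟩, hdisj⟩
  · have h := (hP i hi).2.1
    rw [hlv0] at h
    exact h
  · have h := (hP i hi).2.2.2.1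
    rw [hlv0] at h
    exact h

end PinskerValiant

/-- **Linear-size superconcentrators exist** (Valiant 1976; Pinsker; Pippenger 1977): the named
fact `SuperconcentratorBarrier` holds, with `c = 915` and `n₀ = 1`, witnessed by the
Pinsker–Valiant network `PinskerValiant.net n` ([BurgisserClausenShokrollahi1997] Thm. (13.31),
`s(n) ≤ 39n + O(log n)` there; [Drucker2012] §1.2 p. 5: "there exist superconcentrators with
`O(n)` wires [Val76, Val77]"). [cite: BurgisserClausenShokrollahi1997, Thm. (13.31) (PDF pp. 356–358)] -/
theorem SuperconcentratorBarrier_holds : SuperconcentratorBarrier :=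
  ⟨915, 1, fun n hn =>
    ⟨PinskerValiant.net n, PinskerValiant.isSuperconcentrator_net n, PinskerValiant.edgeCount_net_le hn⟩⟩

end Literature.Barriers.PneNP
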